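import Mathlib
import Summits.Ventures.PercRepro2.CoinChainOneAwareLemmas

/-!
# The pure AND-switch chain with ONE head-aware non-entry and markers on the entered clusters
(blind cell PercRepro2, night-2 g20; proofs/NIGHT2-DARC.md §60.11)

`pureChain_functional_nonneg_of_oneAware`: a single non-entry `z ∈ U ∖ ent'` may have routes into
the head (the head is blind to the OTHER non-entries: `c W = c (W ∩ insert z ent')`), provided
the markers vanish on the entry-free clusters (`x W = 0 = y W` for `W ∩ ent' = ∅`, e.g. point
markers that are entries).  The lifted law of `CoinChainBlindLemmas.lean` is still an OR-tail
pair (`blindOffZ_lsm`, `blindOff_crossZ` of `CoinChainOneAwareLemmas.lean`, fed to the generic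
lift lemmas `liftLaw_lsm_of`, `liftLaw_cross_of` below), and the entry-free correction is a sum
of nonnegative terms because the markers vanish there.
-/

namespace Summit.Ventures.PercRepro2.Coin

open Classical

section ChainOneAware

variable {V : Type*} [DecidableEq V] {R : Type*} [Field R] [LinearOrder R] [IsStrictOrderedRing R]

/-- **The lifted law is log-supermodular** — the generic form: from the log-supermodularity and
the cross inequality of the `off` weight. -/
lemma liftLaw_lsm_of (U ent' : Finset V) (x₀ : V) (ρ : R) (ν c d e : Finset V → R)
    (hρ0 : 0 ≤ ρ) (hρ1 : ρ ≤ 1) (hν0 : ∀ W, 0 ≤ ν W)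
    (hν : ∀ s ⊆ U, ∀ t ⊆ U, ν s * ν t ≤ ν (s ∩ t) * ν (s ∪ t))
    (hc0 : ∀ W, 0 ≤ c W) (hd0 : ∀ W, 0 ≤ d W) (he0 : ∀ W, 0 ≤ e W) (hdc : ∀ W, d W ≤ c W)
    (hee : ∀ s t, e s * e t ≤ e (s ∩ t) * e (s ∪ t))
    (hoff_lsm : ∀ s t, blindOff ent' ρ c d s * blindOff ent' ρ c d t ≤
      blindOff ent' ρ c d (s ∩ t) * blindOff ent' ρ c d (s ∪ t))
    (hoff_cross : ∀ s t, e s * blindOff ent' ρ c d t ≤ blindOff ent' ρ c d (s ∩ t) * e (s ∪ t))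
    (s t : Finset V) :
    liftLaw U ent' x₀ ρ ν c d e s * liftLaw U ent' x₀ ρ ν c d e t ≤
      liftLaw U ent' x₀ ρ ν c d e (s ∩ t) * liftLaw U ent' x₀ ρ ν c d e (s ∪ t) := by
  have hI : (s ∩ t) ∩ U = (s ∩ U) ∩ (t ∩ U) := state_inter s t U
  have hU : (s ∪ t) ∩ U = (s ∩ U) ∪ (t ∩ U) := state_union s t U
  have hν' : ν (s ∩ U) * ν (t ∩ U) ≤ ν ((s ∩ t) ∩ U) * ν ((s ∪ t) ∩ U) := by
    rw [hI, hU]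
    exact hν (s ∩ U) Finset.inter_subset_right (t ∩ U) Finset.inter_subset_right
  have hf : (if x₀ ∈ s then ρ * e (s ∩ U) else blindOff ent' ρ c d (s ∩ U)) *
      (if x₀ ∈ t then ρ * e (t ∩ U) else blindOff ent' ρ c d (t ∩ U)) ≤
      (if x₀ ∈ s ∩ t then ρ * e ((s ∩ t) ∩ U) else blindOff ent' ρ c d ((s ∩ t) ∩ U)) *
      (if x₀ ∈ s ∪ t then ρ * e ((s ∪ t) ∩ U) else blindOff ent' ρ c d ((s ∪ t) ∩ U)) := by
    rw [hI, hU]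
    by_cases hs : x₀ ∈ s <;> by_cases ht : x₀ ∈ t
    · rw [if_pos hs, if_pos ht, if_pos (Finset.mem_inter.2 ⟨hs, ht⟩),
        if_pos (Finset.mem_union_left _ hs)]
      have := hee (s ∩ U) (t ∩ U)
      calc ρ * e (s ∩ U) * (ρ * e (t ∩ U)) = (ρ * ρ) * (e (s ∩ U) * e (t ∩ U)) := by ring
        _ ≤ (ρ * ρ) * (e (s ∩ U ∩ (t ∩ U)) * e (s ∩ U ∪ t ∩ U)) :=
            mul_le_mul_of_nonneg_left this (mul_nonneg hρ0 hρ0)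
        _ = ρ * e (s ∩ U ∩ (t ∩ U)) * (ρ * e (s ∩ U ∪ t ∩ U)) := by ring
    · rw [if_pos hs, if_neg ht, if_neg (fun h => ht (Finset.mem_inter.1 h).2),
        if_pos (Finset.mem_union_left _ hs)]
      have := hoff_cross (s ∩ U) (t ∩ U)
      calc ρ * e (s ∩ U) * blindOff ent' ρ c d (t ∩ U)
          = ρ * (e (s ∩ U) * blindOff ent' ρ c d (t ∩ U)) := by ring
        _ ≤ ρ * (blindOff ent' ρ c d (s ∩ U ∩ (t ∩ U)) * e (s ∩ U ∪ t ∩ U)) :=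
            mul_le_mul_of_nonneg_left this hρ0
        _ = blindOff ent' ρ c d (s ∩ U ∩ (t ∩ U)) * (ρ * e (s ∩ U ∪ t ∩ U)) := by ring
    · rw [if_neg hs, if_pos ht, if_neg (fun h => hs (Finset.mem_inter.1 h).1),
        if_pos (Finset.mem_union_right _ ht)]
      have := hoff_cross (t ∩ U) (s ∩ U)
      rw [Finset.inter_comm (t ∩ U), Finset.union_comm (t ∩ U)] at this
      calc blindOff ent' ρ c d (s ∩ U) * (ρ * e (t ∩ U))
          = ρ * (e (t ∩ U) * blindOff ent' ρ c d (s ∩ U)) := by ring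
        _ ≤ ρ * (blindOff ent' ρ c d (s ∩ U ∩ (t ∩ U)) * e (s ∩ U ∪ t ∩ U)) :=
            mul_le_mul_of_nonneg_left this hρ0
        _ = blindOff ent' ρ c d (s ∩ U ∩ (t ∩ U)) * (ρ * e (s ∩ U ∪ t ∩ U)) := by ring
    · rw [if_neg hs, if_neg ht, if_neg (fun h => hs (Finset.mem_inter.1 h).1),
        if_neg (fun h => by rcases Finset.mem_union.1 h with h | h; exact hs h; exact ht h)]
      exact hoff_lsm (s ∩ U) (t ∩ U)
  unfold liftLaw
  calc ν (s ∩ U) * (if x₀ ∈ s then ρ * e (s ∩ U) else blindOff ent' ρ c d (s ∩ U)) *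
        (ν (t ∩ U) * (if x₀ ∈ t then ρ * e (t ∩ U) else blindOff ent' ρ c d (t ∩ U)))
      = (ν (s ∩ U) * ν (t ∩ U)) *
          ((if x₀ ∈ s then ρ * e (s ∩ U) else blindOff ent' ρ c d (s ∩ U)) *
           (if x₀ ∈ t then ρ * e (t ∩ U) else blindOff ent' ρ c d (t ∩ U))) := by ring
    _ ≤ (ν ((s ∩ t) ∩ U) * ν ((s ∪ t) ∩ U)) *
          ((if x₀ ∈ s ∩ t then ρ * e ((s ∩ t) ∩ U) else blindOff ent' ρ c d ((s ∩ t) ∩ U)) *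
           (if x₀ ∈ s ∪ t then ρ * e ((s ∪ t) ∩ U) else blindOff ent' ρ c d ((s ∪ t) ∩ U))) :=
        mul_le_mul hν' hf
          (mul_nonneg (liftFactor_nonneg U ent' x₀ ρ c d e hρ0 hρ1 hc0 hd0 he0 hdc s)
            (liftFactor_nonneg U ent' x₀ ρ c d e hρ0 hρ1 hc0 hd0 he0 hdc t))
          (mul_nonneg (hν0 _) (hν0 _))
    _ = _ := by ring

/-- **The lifted gate is Holley-above the lifted `R`-law from every cluster containing `x₀`** —
the generic form. -/
lemma liftLaw_cross_of (U ent' : Finset V) (x₀ : V) (ρ : R) (ν c d d' : Finset V → R)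
    (hρ0 : 0 ≤ ρ) (hρ1 : ρ ≤ 1) (hν0 : ∀ W, 0 ≤ ν W)
    (hν : ∀ s ⊆ U, ∀ t ⊆ U, ν s * ν t ≤ ν (s ∩ t) * ν (s ∪ t))
    (hc0 : ∀ W, 0 ≤ c W) (hd0 : ∀ W, 0 ≤ d W) (hd'0 : ∀ W, 0 ≤ d' W) (hdc : ∀ W, d W ≤ c W)
    (hdd' : ∀ s t, d s * d' t ≤ d (s ∩ t) * d' (s ∪ t))
    (hoff_cross : ∀ s t, d' s * blindOff ent' ρ c d t ≤ blindOff ent' ρ c d (s ∩ t) * d' (s ∪ t))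
    (s t : Finset V) (hs : x₀ ∈ s) :
    liftLaw U ent' x₀ ρ ν c d d' s * liftLaw U ent' x₀ ρ ν c d d t ≤
      liftLaw U ent' x₀ ρ ν c d d (s ∩ t) * liftLaw U ent' x₀ ρ ν c d d' (s ∪ t) := by
  have hI : (s ∩ t) ∩ U = (s ∩ U) ∩ (t ∩ U) := state_inter s t U
  have hU : (s ∪ t) ∩ U = (s ∩ U) ∪ (t ∩ U) := state_union s t U
  have hν' : ν (s ∩ U) * ν (t ∩ U) ≤ ν ((s ∩ t) ∩ U) * ν ((s ∪ t) ∩ U) := by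
    rw [hI, hU]
    exact hν (s ∩ U) Finset.inter_subset_right (t ∩ U) Finset.inter_subset_right
  have hf : (ρ * d' (s ∩ U)) *
      (if x₀ ∈ t then ρ * d (t ∩ U) else blindOff ent' ρ c d (t ∩ U)) ≤
      (if x₀ ∈ s ∩ t then ρ * d ((s ∩ t) ∩ U) else blindOff ent' ρ c d ((s ∩ t) ∩ U)) *
      (ρ * d' ((s ∪ t) ∩ U)) := by
    rw [hI, hU]
    by_cases ht : x₀ ∈ t
    · rw [if_pos ht, if_pos (Finset.mem_inter.2 ⟨hs, ht⟩)]
      have := hdd' (t ∩ U) (s ∩ U)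
      rw [Finset.inter_comm (t ∩ U), Finset.union_comm (t ∩ U)] at this
      calc ρ * d' (s ∩ U) * (ρ * d (t ∩ U)) = (ρ * ρ) * (d (t ∩ U) * d' (s ∩ U)) := by ring
        _ ≤ (ρ * ρ) * (d (s ∩ U ∩ (t ∩ U)) * d' (s ∩ U ∪ t ∩ U)) :=
            mul_le_mul_of_nonneg_left this (mul_nonneg hρ0 hρ0)
        _ = ρ * d (s ∩ U ∩ (t ∩ U)) * (ρ * d' (s ∩ U ∪ t ∩ U)) := by ring
    · rw [if_neg ht, if_neg (fun h => ht (Finset.mem_inter.1 h).2)]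
      have := hoff_cross (s ∩ U) (t ∩ U)
      calc ρ * d' (s ∩ U) * blindOff ent' ρ c d (t ∩ U)
          = ρ * (d' (s ∩ U) * blindOff ent' ρ c d (t ∩ U)) := by ring
        _ ≤ ρ * (blindOff ent' ρ c d (s ∩ U ∩ (t ∩ U)) * d' (s ∩ U ∪ t ∩ U)) :=
            mul_le_mul_of_nonneg_left this hρ0
        _ = blindOff ent' ρ c d (s ∩ U ∩ (t ∩ U)) * (ρ * d' (s ∩ U ∪ t ∩ U)) := by ring
  unfold liftLaw
  rw [if_pos hs, if_pos (Finset.mem_union_left _ hs)]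
  calc ν (s ∩ U) * (ρ * d' (s ∩ U)) *
        (ν (t ∩ U) * (if x₀ ∈ t then ρ * d (t ∩ U) else blindOff ent' ρ c d (t ∩ U)))
      = (ν (s ∩ U) * ν (t ∩ U)) * ((ρ * d' (s ∩ U)) *
          (if x₀ ∈ t then ρ * d (t ∩ U) else blindOff ent' ρ c d (t ∩ U))) := by ring
    _ ≤ (ν ((s ∩ t) ∩ U) * ν ((s ∪ t) ∩ U)) *
          ((if x₀ ∈ s ∩ t then ρ * d ((s ∩ t) ∩ U) else blindOff ent' ρ c d ((s ∩ t) ∩ U)) *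
           (ρ * d' ((s ∪ t) ∩ U))) :=
        mul_le_mul hν' hf
          (mul_nonneg (mul_nonneg hρ0 (hd'0 _))
            (liftFactor_nonneg U ent' x₀ ρ c d d hρ0 hρ1 hc0 hd0 hd0 hdc t))
          (mul_nonneg (hν0 _) (hν0 _))
    _ = _ := by ring

omit [LinearOrder R] [IsStrictOrderedRing R] in
/-- The lifted gate sums to the chain gate minus the entry-free pivotal mass (no blindness). -/
lemma liftLaw_sum_G' (U ent' : Finset V) (x₀ : V) (hx₀ : x₀ ∉ U) (ρ : R) (ν c d d' : Finset V → R)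
    (J : Finset V → R) :
    ∑ W' ∈ (insert x₀ U).powerset, liftLaw U ent' x₀ ρ ν c d d' W' * J (W' ∩ U) =
      ∑ W ∈ U.powerset, ν W * chainMix ∅ ent' ρ c d' W * J W -
        ∑ W ∈ U.powerset, ν W * ((if ∃ r ∈ ent', r ∈ W then (0 : R) else 1) * (ρ * (d W - d' W))) * J W := by
  rw [liftLaw_sum U ent' x₀ hx₀ ρ ν c d d' J, ← Finset.sum_sub_distrib]
  refine Finset.sum_congr rfl fun W _ => ?_
  rw [blindOff_add']; ring

/-- **THE PURE CHAIN WITH ONE HEAD-AWARE NON-ENTRY `z` AND MARKERS ON THE ENTERED CLUSTERS.**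
The head is blind to the non-entries other than `z` (`c W = c (W ∩ insert z ent')` etc.); the
markers vanish on the entry-free clusters; then the chain functional is nonnegative for every
`ρ`. -/
theorem pureChain_functional_nonneg_of_oneAware (U ent' : Finset V) (z x₀ : V) (hx₀ : x₀ ∉ U)
    (ν c d d' : Finset V → R) (ρ : R) (hρ0 : 0 ≤ ρ) (hρ1 : ρ ≤ 1)
    (hν0 : ∀ W, 0 ≤ ν W) (hν : ∀ s ⊆ U, ∀ t ⊆ U, ν s * ν t ≤ ν (s ∩ t) * ν (s ∪ t))
    (hc0 : ∀ W, 0 ≤ c W) (hd0 : ∀ W, 0 ≤ d W) (hd'0 : ∀ W, 0 ≤ d' W)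
    (hdc : ∀ W, d W ≤ c W) (hd'd : ∀ W, d' W ≤ d W)
    (hcc : ∀ s t, c s * c t ≤ c (s ∩ t) * c (s ∪ t))
    (hdd : ∀ s t, d s * d t ≤ d (s ∩ t) * d (s ∪ t))
    (hd'd' : ∀ s t, d' s * d' t ≤ d' (s ∩ t) * d' (s ∪ t))
    (hdd' : ∀ s t, d s * d' t ≤ d (s ∩ t) * d' (s ∪ t))
    (hcd : ∀ s t, c s * d t ≤ c (s ∩ t) * d (s ∪ t))
    (hcd' : ∀ s t, c s * d' t ≤ c (s ∩ t) * d' (s ∪ t))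
    (hratio : ∀ s t, s ⊆ t → d s * c t ≤ c s * d t)
    (hratio' : ∀ s t, s ⊆ t → d' s * c t ≤ c s * d' t)
    (hbc : ∀ W, c W = c (W ∩ insert z ent')) (hbd : ∀ W, d W = d (W ∩ insert z ent'))
    (hbd' : ∀ W, d' W = d' (W ∩ insert z ent'))
    (x y : Finset V → R) (hx0 : ∀ W, 0 ≤ x W) (hy0 : ∀ W, 0 ≤ y W)
    (hxm : ∀ s t, x s ≤ x (s ∪ t)) (hym : ∀ s t, y s ≤ y (s ∪ t))
    (hxI : ∀ W, (¬ ∃ r ∈ ent', r ∈ W) → x W = 0) (hyI : ∀ W, (¬ ∃ r ∈ ent', r ∈ W) → y W = 0) :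
    0 ≤ (∑ W ∈ U.powerset, ν W * chainMix ∅ ent' ρ c d W) ^ 2 *
          (∑ W ∈ U.powerset, ν W * chainMix ∅ ent' ρ c d' W * (x W * y W))
        - (∑ W ∈ U.powerset, ν W * chainMix ∅ ent' ρ c d W) *
          (∑ W ∈ U.powerset, ν W * chainMix ∅ ent' ρ c d W * x W) *
          (∑ W ∈ U.powerset, ν W * chainMix ∅ ent' ρ c d' W * y W)
        - (∑ W ∈ U.powerset, ν W * chainMix ∅ ent' ρ c d W) *
          (∑ W ∈ U.powerset, ν W * chainMix ∅ ent' ρ c d W * y W) *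
          (∑ W ∈ U.powerset, ν W * chainMix ∅ ent' ρ c d' W * x W)
        + (∑ W ∈ U.powerset, ν W * chainMix ∅ ent' ρ c d W * x W) *
          (∑ W ∈ U.powerset, ν W * chainMix ∅ ent' ρ c d W * y W) *
          (∑ W ∈ U.powerset, ν W * chainMix ∅ ent' ρ c d' W) := by
  have hd'c : ∀ W, d' W ≤ c W := fun W => le_trans (hd'd W) (hdc W)
  have hoff_lsm := blindOffZ_lsm ent' z ρ c d hρ0 hρ1 hc0 hd0 hdc hcc hratio hbc hbd
  have hcross_d := blindOff_crossZ ent' z ρ c d d hρ0 hρ1 hc0 hd0 hd0 hdc hdc hcc hcd hratio hratio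
    hbc hbd hbd
  have hcross_d' := blindOff_crossZ ent' z ρ c d d' hρ0 hρ1 hc0 hd0 hd'0 hdc hd'c hcc hcd' hratio
    hratio' hbc hbd hbd'
  have key := gate_functional_nonneg (insert x₀ U) {x₀} (liftLaw U ent' x₀ ρ ν c d d)
    (liftLaw U ent' x₀ ρ ν c d d') (fun W' => x (W' ∩ U)) (fun W' => y (W' ∩ U))
    (liftLaw_nonneg U ent' x₀ ρ ν c d d hρ0 hρ1 hν0 hc0 hd0 hd0 hdc)
    (liftLaw_nonneg U ent' x₀ ρ ν c d d' hρ0 hρ1 hν0 hc0 hd0 hd'0 hdc)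
    (fun W' => hx0 _) (fun W' => hy0 _)
    (fun s t => by
      show x (s ∩ U) ≤ x ((s ∪ t) ∩ U)
      rw [state_union]; exact hxm _ _)
    (fun s t => by
      show y (s ∩ U) ≤ y ((s ∪ t) ∩ U)
      rw [state_union]; exact hym _ _)
    (fun s _ t _ => liftLaw_lsm_of U ent' x₀ ρ ν c d d hρ0 hρ1 hν0 hν hc0 hd0 hd0 hdc hdd
      hoff_lsm hcross_d s t)
    (fun s _ t _ => liftLaw_lsm_of U ent' x₀ ρ ν c d d' hρ0 hρ1 hν0 hν hc0 hd0 hd'0 hdc hd'd'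
      hoff_lsm hcross_d' s t)
    (fun s _ t _ hs => by
      obtain ⟨r, hr, hrs⟩ := hs
      rw [Finset.mem_singleton] at hr
      rw [hr] at hrs
      exact liftLaw_cross_of U ent' x₀ ρ ν c d d' hρ0 hρ1 hν0 hν hc0 hd0 hd'0 hdc hdd' hcross_d'
        s t hrs)
    (fun W' hW' => liftLaw_off U ent' x₀ ρ ν c d d' W' hW')
  have eΛ : ∑ W' ∈ (insert x₀ U).powerset, liftLaw U ent' x₀ ρ ν c d d W' =
      ∑ W ∈ U.powerset, ν W * chainMix ∅ ent' ρ c d W := by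
    have h := liftLaw_sum_R U ent' x₀ hx₀ ρ ν c d (fun _ => (1 : R))
    simp only [mul_one] at h
    exact h
  have eΛ₁ := liftLaw_sum_R U ent' x₀ hx₀ ρ ν c d x
  have eΛ₂ := liftLaw_sum_R U ent' x₀ hx₀ ρ ν c d y
  have eM : ∑ W' ∈ (insert x₀ U).powerset, liftLaw U ent' x₀ ρ ν c d d' W' =
      ∑ W ∈ U.powerset, ν W * chainMix ∅ ent' ρ c d' W -
        ∑ W ∈ U.powerset, ν W * ((if ∃ r ∈ ent', r ∈ W then (0 : R) else 1) * (ρ * (d W - d' W))) := by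
    have h := liftLaw_sum_G' U ent' x₀ hx₀ ρ ν c d d' (fun _ => (1 : R))
    simp only [mul_one] at h
    exact h
  have eM₁ := liftLaw_sum_G' U ent' x₀ hx₀ ρ ν c d d' x
  have eM₂ := liftLaw_sum_G' U ent' x₀ hx₀ ρ ν c d d' y
  have eM₁₂ := liftLaw_sum_G' U ent' x₀ hx₀ ρ ν c d d' (fun W => x W * y W)
  rw [eΛ, eΛ₁, eΛ₂, eM, eM₁, eM₂, eM₁₂] at key
  -- the correction: the markers vanish on the entry-free clusters
  set D : Finset V → R := fun W => ν W * ((if ∃ r ∈ ent', r ∈ W then (0 : R) else 1) * (ρ * (d W - d' W)))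
    with hD
  have hD0 : ∀ W, 0 ≤ D W := fun W => by
    simp only [hD]
    refine mul_nonneg (hν0 W) (mul_nonneg ?_ (mul_nonneg hρ0 (by linarith [hd'd W])))
    split_ifs <;> norm_num
  have hDx : ∀ W, D W * x W = 0 := fun W => by
    simp only [hD]
    by_cases h : ∃ r ∈ ent', r ∈ W
    · rw [if_pos h]; ring
    · rw [hxI W h]; ring
  have hDy : ∀ W, D W * y W = 0 := fun W => by
    simp only [hD]
    by_cases h : ∃ r ∈ ent', r ∈ W
    · rw [if_pos h]; ring
    · rw [hyI W h]; ring
  have e1 : ∑ W ∈ U.powerset, D W * x W = 0 := Finset.sum_eq_zero fun W _ => hDx W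
  have e2 : ∑ W ∈ U.powerset, D W * y W = 0 := Finset.sum_eq_zero fun W _ => hDy W
  have e12 : ∑ W ∈ U.powerset, D W * (x W * y W) = 0 :=
    Finset.sum_eq_zero fun W _ => by rw [← mul_assoc, hDx W, zero_mul]
  have ha0 : 0 ≤ ∑ W ∈ U.powerset, D W := Finset.sum_nonneg fun W _ => hD0 W
  set Λ := ∑ W ∈ U.powerset, ν W * chainMix ∅ ent' ρ c d W
  set Λ₁ := ∑ W ∈ U.powerset, ν W * chainMix ∅ ent' ρ c d W * x W
  set Λ₂ := ∑ W ∈ U.powerset, ν W * chainMix ∅ ent' ρ c d W * y W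
  set M := ∑ W ∈ U.powerset, ν W * chainMix ∅ ent' ρ c d' W
  set M₁ := ∑ W ∈ U.powerset, ν W * chainMix ∅ ent' ρ c d' W * x W
  set M₂ := ∑ W ∈ U.powerset, ν W * chainMix ∅ ent' ρ c d' W * y W
  set M₁₂ := ∑ W ∈ U.powerset, ν W * chainMix ∅ ent' ρ c d' W * (x W * y W)
  set a := ∑ W ∈ U.powerset, D W
  have hΛ₁0 : 0 ≤ Λ₁ := Finset.sum_nonneg fun W _ =>
    mul_nonneg (mul_nonneg (hν0 W) (chainMix_nonneg' ent' ρ c d hρ0 hρ1 hc0 hd0 hdc W)) (hx0 W)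
  have hΛ₂0 : 0 ≤ Λ₂ := Finset.sum_nonneg fun W _ =>
    mul_nonneg (mul_nonneg (hν0 W) (chainMix_nonneg' ent' ρ c d hρ0 hρ1 hc0 hd0 hdc W)) (hy0 W)
  have hkey : 0 ≤ Λ ^ 2 * (M₁₂ - ∑ W ∈ U.powerset, D W * (x W * y W))
      - Λ * Λ₁ * (M₂ - ∑ W ∈ U.powerset, D W * y W)
      - Λ * Λ₂ * (M₁ - ∑ W ∈ U.powerset, D W * x W)
      + Λ₁ * Λ₂ * (M - a) := key
  rw [e1, e2, e12] at hkey
  have : Λ ^ 2 * M₁₂ - Λ * Λ₁ * M₂ - Λ * Λ₂ * M₁ + Λ₁ * Λ₂ * M =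
      (Λ ^ 2 * (M₁₂ - 0) - Λ * Λ₁ * (M₂ - 0) - Λ * Λ₂ * (M₁ - 0) + Λ₁ * Λ₂ * (M - a)) +
        Λ₁ * Λ₂ * a := by ring
  rw [this]
  exact add_nonneg hkey (mul_nonneg (mul_nonneg hΛ₁0 hΛ₂0) ha0)

end ChainOneAware

end Summit.Ventures.PercRepro2.Coin
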